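import Summits.NavierStokesRegularity.NavierStokesRegularity.Theorems.QuietScarPocketDoorZoomEnergies
import Summits.NavierStokesRegularity.NavierStokesRegularity.Theorems.QuietScarPocketDoorZoomPressureD
import Literature.Analysis.FluidPDE.ChenTsaiZhang2022LocalEnergyEstimates
import Literature.Analysis.FluidPDE.LocalTypeIWeakSerrinProofs
import Literature.Analysis.FluidPDE.ClassicalSuitableRegionEnergy
import Literature.Analysis.FluidPDE.LocalTypeI
import Literature.Analysis.FluidPDE.NSLerayHopfSereginMild

/-!
# QuietScarPocketDoorZoomClass — door S31 «QuietScarPocketDoor» (nsreg-p1 g25 ROUND-29 v2.1, texts `r29/Sketch31.lean`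
# 363b5766493b6c28; Defs p622283), K-piece PK1 `scarPocketZoom_holds`, file F2: THE UNIFORM ALBRITTON–BARKER QUANTITY OF THE
# PINEAU–VICOL CLASS ON A SMALL APEX CYLINDER

* `exists_pv_typeIBound_le` (F2 of the LEAD skeleton `HOME/ns-s30-p1/PK1-Skeleton.lean`): for every `C_u` there is `I(C_u)` and
  for every shell level `C_p` a radius `0 < μ ≤ 1/64` with `𝐈(Q(0,μ); u, p, ∇u) ≤ I` for every classical solution of the
  Pineau–Vicol class — the input «uniform `𝐈`» of the class-zoom engine `LocalTypeIBlowup.exists_typeIAncientMild_zoomLimit_seq`.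

Proof: on every sub-cylinder `Q(z,r) ⊆ Q(0,μ)`, `μ = μ_D/4`, the doubled cylinder `Q(z,2r)` lies in `Q(0,μ_D) ⊆ Q(0,1)`, so
`C(2r;z) ≤ K_C C_u³` (F1a `exists_pv_cknC_le`) and `D(2r;z) ≤ K_D` (F1b `exists_pv_cknD_le`); the local energy inequality in
the form of Chen–Tsai–Zhang (`ChenTsaiZhang2022.cknAEss_add_cknE_le_of_le`: `A + E ≤ N(1+2M)` from `C, D ≤ M` at `2r`) bounds
`A(r;z) + E(r;z)`, and `D_osc ≤ 4D` (`AlbrittonBarker2019.cknDOsc_le_four_mul_cknD`).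

Door S31 is a regularity CRITERION about a HYPOTHETICAL one-point Type-I blow-up; item 0056 `NoTypeII` and NS regularity are
NOT proved and stay OPEN.
-/

noncomputable section

set_option linter.dupNamespace false

namespace Summit.NavierStokesRegularity.NavierStokesRegularity.Theorems.QuietScarPocketDoor

open MeasureTheory Set Function Filter Topology TopologicalSpace Metric
open scoped NNReal ENNReal Topology
open Literature.Analysis Literature.Analysis.FluidPDE

/-- doubling inside a quarter cylinder: `Q(z,r) ⊆ Q(0,ρ/4)` ⇒ `Q(z,2r) ⊆ Q(0,ρ)`. -/
theorem parabolicCylinder_two_mul_subset {r ρ : ℝ} (hr : 0 < r) (hρ : 0 < ρ) {z : ℝ × EuclideanSpace ℝ (Fin 3)}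
    (hQ : parabolicCylinder r z ⊆ parabolicCylinder (ρ / 4) (0 : ℝ × EuclideanSpace ℝ (Fin 3))) :
    parabolicCylinder (2 * r) z ⊆ parabolicCylinder ρ (0 : ℝ × EuclideanSpace ℝ (Fin 3)) := by
  obtain ⟨hz1, hz0, hball, hrρ⟩ := apex_subcylinder hr (by positivity : 0 < ρ / 4) hQ
  have hz2 : ‖z.2‖ < ρ / 4 := by
    have h := hball (mem_ball_self hr)
    rwa [mem_ball, dist_zero_right] at h
  intro w hw
  obtain ⟨hwt, hwx⟩ := mem_prod.1 hw
  refine mk_mem_prod ⟨?_, ?_⟩ ?_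
  · simp only [Prod.fst_zero]
    nlinarith [hwt.1, hz1, hrρ]
  · simp only [Prod.fst_zero]
    linarith [hwt.2]
  · rw [mem_ball, dist_eq_norm] at hwx
    rw [mem_ball, Prod.snd_zero, dist_zero_right]
    calc ‖w.2‖ = ‖(w.2 - z.2) + z.2‖ := by rw [sub_add_cancel]
      _ ≤ ‖w.2 - z.2‖ + ‖z.2‖ := norm_add_le _ _
      _ < 2 * r + ρ / 4 := by linarith
      _ ≤ ρ := by linarith

/-- **F2 — the Albritton–Barker quantity of the Pineau–Vicol class is bounded on a small apex cylinder, uniformly in the shell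
level**: `𝐈(Q(0,μ); u, p, ∇u) ≤ I(C_u)` with `0 < μ = μ(C_u,C_p) ≤ 1/64`. -/
theorem exists_pv_typeIBound_le (Cu : ℝ) : ∃ I : ℝ≥0, ∀ Cp : ℝ, ∃ μ : ℝ, 0 < μ ∧ μ ≤ 1 / 64 ∧
    ∀ (u : ℝ → EuclideanSpace ℝ (Fin 3) → EuclideanSpace ℝ (Fin 3)) (p : ℝ → EuclideanSpace ℝ (Fin 3) → ℝ),
    IsClassicalNSSolutionOnRegion (Ico (-1 : ℝ) 0 ×ˢ ball (0 : EuclideanSpace ℝ (Fin 3)) 1) 1 0 u p →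
    (∀ t ∈ Ico (-1 : ℝ) 0, ∀ x ∈ ball (0 : EuclideanSpace ℝ (Fin 3)) 1, ‖u t x‖ ≤ Cu / (Real.sqrt (-t) + ‖x‖)) →
    (∀ t ∈ Ico (-1 : ℝ) 0, ∀ x : EuclideanSpace ℝ (Fin 3), 1 / 2 < ‖x‖ → ‖x‖ < 3 / 4 → |p t x| ≤ Cp) →
      typeIBound (parabolicCylinder μ (0 : ℝ × EuclideanSpace ℝ (Fin 3))) u p (fun t x => fderiv ℝ (u t) x) ≤ I := by
  obtain ⟨KC, hKC⟩ := exists_pv_cknC_le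
  obtain ⟨KD, hKD⟩ := exists_pv_cknD_le Cu
  obtain ⟨N, hN⟩ := ChenTsaiZhang2022.cknAEss_add_cknE_le_of_le
  set M : ℝ≥0∞ := max ((KC : ℝ≥0∞) * ENNReal.ofReal (Cu ^ 3)) KD with hM_def
  have hMtop : M ≠ ⊤ :=
    (max_lt (ENNReal.mul_lt_top ENNReal.coe_lt_top ENNReal.ofReal_lt_top) ENNReal.coe_lt_top).ne
  have hItop : (N : ℝ≥0∞) * (1 + 2 * M) + M + 4 * M ≠ ⊤ := by
    have h1 : (1 : ℝ≥0∞) + 2 * M ≠ ⊤ :=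
      ENNReal.add_ne_top.2 ⟨ENNReal.one_ne_top, ENNReal.mul_ne_top (by simp) hMtop⟩
    exact ENNReal.add_ne_top.2 ⟨ENNReal.add_ne_top.2 ⟨ENNReal.mul_ne_top ENNReal.coe_ne_top h1, hMtop⟩,
      ENNReal.mul_ne_top (by simp) hMtop⟩
  refine ⟨((N : ℝ≥0∞) * (1 + 2 * M) + M + 4 * M).toNNReal, fun Cp => ?_⟩
  obtain ⟨μ₁, hμ₁, hμ₁32, hD⟩ := hKD Cp
  refine ⟨μ₁ / 4, by positivity, by linarith, fun u p hreg hI hP => ?_⟩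
  rw [ENNReal.coe_toNNReal hItop]
  -- the pair is suitable on the open unit cylinder, with the classical gradient as weak gradient
  have hO : IsOpen (Ioo (-1 : ℝ) 0 ×ˢ ball (0 : EuclideanSpace ℝ (Fin 3)) 1) := isOpen_Ioo.prod isOpen_ball
  have hreg' := hreg.mono_of_isOpen (prod_mono Ioo_subset_Ico_self Subset.rfl) hO
  have hQ1O : ((parabolicCylinderOpens 1 (0 : ℝ × EuclideanSpace ℝ (Fin 3)) : Opens (ℝ × EuclideanSpace ℝ (Fin 3))) :
      Set (ℝ × EuclideanSpace ℝ (Fin 3))) ⊆ Ioo (-1 : ℝ) 0 ×ˢ ball (0 : EuclideanSpace ℝ (Fin 3)) 1 := by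
    rw [coe_parabolicCylinderOpens]
    intro w hw
    obtain ⟨hwt, hwx⟩ := mem_prod.1 hw
    simp only [Prod.fst_zero, one_pow, zero_sub] at hwt
    exact mk_mem_prod hwt (by simpa using hwx)
  have hsw : IsSuitableWeakSolutionOn (parabolicCylinderOpens 1 (0 : ℝ × EuclideanSpace ℝ (Fin 3))) 1 0 u p :=
    hreg'.isSuitableWeakSolutionOn_of_subset one_pos hQ1O
  have hwg : HasWeakSpatialGradientOn (parabolicCylinderOpens 1 (0 : ℝ × EuclideanSpace ℝ (Fin 3))) u
      (fun t x => fderiv ℝ (u t) x) := hreg'.hasWeakSpatialGradientOn hO hQ1O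
  refine typeIBound_le_iff.2 fun r hr z hQ => ?_
  -- the cylinders involved
  have h2Q : parabolicCylinder (2 * r) z ⊆ parabolicCylinder μ₁ (0 : ℝ × EuclideanSpace ℝ (Fin 3)) :=
    parabolicCylinder_two_mul_subset hr hμ₁ hQ
  have hμ₁1 : μ₁ ≤ 1 := hμ₁32.trans (by norm_num)
  have h2Q1 : parabolicCylinder (2 * r) z ⊆ parabolicCylinder 1 (0 : ℝ × EuclideanSpace ℝ (Fin 3)) :=
    h2Q.trans (parabolicCylinder_subset_of_le hμ₁.le hμ₁1 _)
  have hrr : parabolicCylinder r z ⊆ parabolicCylinder (2 * r) z :=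
    parabolicCylinder_subset_of_le hr.le (by linarith) _
  have hQμ : parabolicCylinder r z ⊆ parabolicCylinder μ₁ (0 : ℝ × EuclideanSpace ℝ (Fin 3)) := hrr.trans h2Q
  have hQ1 : parabolicCylinder r z ⊆ parabolicCylinder 1 (0 : ℝ × EuclideanSpace ℝ (Fin 3)) := hrr.trans h2Q1
  -- `C` and `D` at radii `2r` and `r`
  have hC2 : cknC (2 * r) z u ≤ M := (hKC Cu u hI (2 * r) z (by positivity) h2Q1).trans (le_max_left _ _)
  have hD2 : cknD (2 * r) z p ≤ M := (hD u p hreg hI hP (2 * r) z (by positivity) h2Q).trans (le_max_right _ _)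
  have hC1 : cknC r z u ≤ M := (hKC Cu u hI r z hr hQ1).trans (le_max_left _ _)
  have hD1 : cknD r z p ≤ M := (hD u p hreg hI hP r z hr hQμ).trans (le_max_right _ _)
  -- `A + E` from the local energy inequality
  have hAE : cknAEss r z u + cknE r z (fun t x => fderiv ℝ (u t) x) ≤ N * (1 + 2 * M) :=
    hN _ u p _ hsw hwg z r hr (by rw [coe_parabolicCylinderOpens]; exact h2Q1) M hC2 hD2
  -- `D_osc ≤ 4 D`
  have hpm : AEStronglyMeasurable (uncurry p) (volume.restrict (parabolicCylinder r z)) := by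
    have hc : ContinuousOn (uncurry p) (parabolicCylinder r z) :=
      hreg.smooth_pressure.continuousOn.mono (hQ1.trans (hQ1O.trans (prod_mono Ioo_subset_Ico_self Subset.rfl)))
    exact hc.aestronglyMeasurable (measurableSet_Ioo.prod measurableSet_ball)
  have hOsc : cknDOsc r z p ≤ 4 * M :=
    (AlbrittonBarker2019.cknDOsc_le_four_mul_cknD hr hpm).trans (by gcongr)
  -- sum
  calc abScaledSum r z u p (fun t x => fderiv ℝ (u t) x)
      = (cknAEss r z u + cknE r z (fun t x => fderiv ℝ (u t) x)) + cknC r z u + cknDOsc r z p := by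
        simp only [abScaledSum]; ring
    _ ≤ N * (1 + 2 * M) + M + 4 * M := by gcongr

end Summit.NavierStokesRegularity.NavierStokesRegularity.Theorems.QuietScarPocketDoor

end
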